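import Mathlib
import Literature.NumberTheory.Irrationality.Brown2016.DinnerParties
import Literature.NumberTheory.Irrationality.Brown2016.OddConfigurations
import Summits.KontsevichZagierPeriods.Zeta5Search.Families.CellularIntegral
import HarnessLib

/-!
# ζ(5) search — Families: the generalised `π¹⁰_odd` cell in `fam-brown9`'s symmetric coordinates (homogeneity, convergence polytope)

HONEST FRAMING: systematic search; no irrationality claim unless certified.

Cell `pub-zeta5`, seat P2, for `fam-brown9` (FAMILY.md v1.2 §12: "the N = 10 Brown–Zudilin dictionary generalised
`π¹⁰_odd ≅ F̃₉`, found and data-certified on leading coefficients") and `fam-vwp`.  fam-brown9's dictionary uses symmetric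
parameters `s = (s₀; s₁,…,s₉)` (the shape of [BrownZudilin2022, §10]) with the cellular side `σ = π¹⁰_odd =
(1,3,7,2,8,6,9,5,10,4)` and the exponent data
`a = (s₁+s₂, s₀−s₂, s₂+s₃, s₄+s₅, s₆+s₇, s₈+s₉, s₀−s₉, s₆+s₉, s₄+s₇, s₃+s₅)` (edges of `δ⁰`),
`bσ = (s₁+s₃, s₀−s₁, s₁+s₈, s₀−s₈, s₆+s₈, s₇+s₉, s₄+s₆, s₅+s₇, s₃+s₄, s₂+s₅)` (edges of `σδ⁰`).
This file types that data as an instance of `Families/CellularIntegral.lean` and PROVES, for every `s ∈ ℤ¹⁰`: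
* `homogeneous_tenOddSym` — fam-brown9's "homogeneity holds identically" [Brown2016, §5.1 (5.2)];
* `brownConvergent_tenOddSym_iff` — Brown's chord-by-chord convergence condition [Brown2016, §2.4, §3.4] for this family is
  EQUIVALENT to the sixteen inequalities `s₀ ≥ s_j (j = 2,3,4,5,6,7,9)`, the eight "pair-type" forms
  `s₁+s₂, s₂+s₃, s₃+s₅, s₄+s₅, s₄+s₇, s₆+s₇, s₆+s₉, s₈+s₉ ≥ 0` (= the Hamiltonian path `1–2–3–5–4–7–6–9–8` of FAMILY.md §12;
  the two `b`-type forms `s₀−s₁`, `s₀−s₈` at its end points are NOT convergence conditions) and `Σ_{j≥1} s_j − s₀ + 2 ≥ 0`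
  (70 valuations, 35 distinct, 16 irredundant by exact LP, HOME `code/p2/`; the equivalence is kernel-checked);
* `tenOddSym_plan` — the plan `(1,3,7,2,8,6,9,5,10,4)` is the tree's `Brown2016.tenOdd = piOdd 5` up to `Brown2016.Equivalent`
  and is injective.
Nothing here asserts the dictionary's period identity (a CONJECTURE of fam-brown9, data-supported); only exponent bookkeeping.
-/

noncomputable section

namespace Summit.KontsevichZagierPeriods.Zeta5Search.Families.Cellular

open Literature.NumberTheory.Irrationality

/-- `π¹⁰_odd` in fam-brown9's representative `(1,3,7,2,8,6,9,5,10,4)` (0-based values). -/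
def tenOddSym : Fin 10 → Fin 10 := ![0, 2, 6, 1, 7, 5, 8, 4, 9, 3]

/-- `tenOddSym` is the plan `(1,3,7,2,8,6,9,5,10,4)` read 0-based, injective, and in the configuration of the tree's
`Brown2016.tenOdd` (`= piOdd 5 = (10,2,9,3,8,4,7,5,1,6)`). [Brown2016, Def. 7.1, App. 2 §10.2.6] -/
theorem tenOddSym_plan : tenOddSym = ofSeating (ℓ := 7) [1, 3, 7, 2, 8, 6, 9, 5, 10, 4] ∧ Function.Injective tenOddSym ∧
    Brown2016.Equivalent 10 [1, 3, 7, 2, 8, 6, 9, 5, 10, 4] Brown2016.tenOdd := by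
  refine ⟨by decide, by decide, by decide⟩

/-- fam-brown9's numerator exponents on the edges of `δ⁰` in symmetric coordinates:
`a = (s₁+s₂, s₀−s₂, s₂+s₃, s₄+s₅, s₆+s₇, s₈+s₉, s₀−s₉, s₆+s₉, s₄+s₇, s₃+s₅)`. -/
def tenOddA (s : Fin 10 → ℤ) : Fin 10 → ℤ :=
  ![s 1 + s 2, s 0 - s 2, s 2 + s 3, s 4 + s 5, s 6 + s 7, s 8 + s 9, s 0 - s 9, s 6 + s 9, s 4 + s 7, s 3 + s 5]

/-- fam-brown9's denominator exponents on the edges of `σδ⁰` (by position) in symmetric coordinates: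
`bσ = (s₁+s₃, s₀−s₁, s₁+s₈, s₀−s₈, s₆+s₈, s₇+s₉, s₄+s₆, s₅+s₇, s₃+s₄, s₂+s₅)`. -/
def tenOddB (s : Fin 10 → ℤ) : Fin 10 → ℤ :=
  ![s 1 + s 3, s 0 - s 1, s 1 + s 8, s 0 - s 8, s 6 + s 8, s 7 + s 9, s 4 + s 6, s 5 + s 7, s 3 + s 4, s 2 + s 5]

/-- "Homogeneity holds identically": Brown's equations (5.2) for the dictionary data, for every `s`. [Brown2016, §5.1 (5.2)] -/
theorem homogeneous_tenOddSym (s : Fin 10 → ℤ) : Homogeneous tenOddSym (tenOddA s) (tenOddB s) := by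
  have e : (-1 : Fin 10) = 9 := by decide
  intro i
  fin_cases i <;> simp [tenOddSym, tenOddA, tenOddB, e] <;> ring

/-- The region of convergence of the generalised `π¹⁰_odd` family in symmetric coordinates: Brown's chord condition
(all `10 × 7` valuations) is equivalent to the sixteen inequalities below (irredundant over `ℝ`; exact LP proposal,
kernel-checked equivalence). [Brown2016, §2.4 (2.3), §3.4, §5.2] -/
theorem brownConvergent_tenOddSym_iff (s : Fin 10 → ℤ) :
    BrownConvergent tenOddSym (tenOddA s) (tenOddB s) ↔
      0 ≤ s 0 - s 2 ∧
      0 ≤ s 0 - s 3 ∧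
      0 ≤ s 0 - s 4 ∧
      0 ≤ s 0 - s 5 ∧
      0 ≤ s 0 - s 6 ∧
      0 ≤ s 0 - s 7 ∧
      0 ≤ s 0 - s 9 ∧
      0 ≤ s 1 + s 2 ∧
      0 ≤ s 2 + s 3 ∧
      0 ≤ s 3 + s 5 ∧
      0 ≤ s 4 + s 5 ∧
      0 ≤ s 4 + s 7 ∧
      0 ≤ s 6 + s 7 ∧
      0 ≤ s 6 + s 9 ∧
      0 ≤ s 8 + s 9 ∧
      0 ≤ -s 0 + s 1 + s 2 + s 3 + s 4 + s 5 + s 6 + s 7 + s 8 + s 9 + 2 := by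
  unfold BrownConvergent twoOrd
  dsimp only [Nat.reduceAdd]
  simp only [forall_fin10, forall_fin7, sum_fin10]
  simp [sameSide, tenOddSym, tenOddA, tenOddB]
  constructor <;> intro h <;> and_intros <;> omega

/-- In particular every ray `s = n·s⁰` with `s⁰` in the (conic part of the) region is Brown-convergent for `n ≥ 1`; e.g.
fam-brown9's base point `b = (4;1⁹)`, i.e. `s = (2;1⁹)`: -/
theorem brownConvergent_tenOddSym_base : BrownConvergent tenOddSym (tenOddA ![2, 1, 1, 1, 1, 1, 1, 1, 1, 1])
    (tenOddB ![2, 1, 1, 1, 1, 1, 1, 1, 1, 1]) := by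
  rw [brownConvergent_tenOddSym_iff]
  simp

end Summit.KontsevichZagierPeriods.Zeta5Search.Families.Cellular
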